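import Summits.AtomisticToContinuum.BoseEinsteinCondensation.Theorems.BECGroundStateSOSBoundaryTransferWeakHardWallLimitModulus
import Literature.MathematicalPhysics.QuantumManyBody.BoseGasDirichletWall
import Literature.MathematicalPhysics.QuantumManyBody.CondensateOccupationStability
import Mathlib.MeasureTheory.Integral.MeanInequalities

/-!
# Route `BECGroundStateSOS`, crux `BoundaryTransferWeak` (stmt-AtomisticToContinuum-0827),
# line `rim-squeeze-monotone-coherence`, stub (L): shrinking a Dirichlet state into a smaller cube

Supports (does not close) stmt-AtomisticToContinuum-0827; auxiliary block of the registered stub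
`stub_hardWallLimit` (L) (lead c3). Second half of the near-minimiser transfer across the hard wall
(`…HardWallLimitAux.lean`): after the rim-layer cut-off has produced a Dirichlet state of the
FATTENED cube of side `ℓ₁ = L/2 + 4h` (`…HardWallLimitCutoffState.lean`), it must be squeezed back
into the cube of side `L/2 = s ℓ₁`, `s = (L/2)/ℓ₁ ↑ 1` as `h ↓ 0`. This is done by the dilation
`Φ ↦ Φ_s`, `Φ_s(Y) = s^{-3N/2} Φ(Y/s)` of the tree (`TrialState.dilate`), at a cost that is small
UNIFORMLY on bounded-energy families — for BOUNDED pair potentials `v ≤ M`: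

* `lintegral_kineticDensity_dilate` — `∫|∇Φ_s|² = s⁻² ∫|∇Φ|²` (`TrialState.energy_dilate` at `v = 0`);
* `lintegral_dilate_sub_sq_le` — `∫|Φ_s - Φ|² ≤ 2·3N(1-s) + 2·3N·3(s⁻¹-1)²ℓ₁² ∫|∇Φ|²`
  (normalisation defect `(1 - s^{3N/2})² ≤ 3N(1-s)`, and the dilation modulus
  `lintegral_sub_dilate_sq_le` of `…HardWallLimitModulus.lean`);
* `lintegral_interaction_sq_le_add` — for `v ≤ M` the potential energy is `L²`-Lipschitz on the
  unit ball: `∫ V|f|² ≤ ∫ V|g|² + N²M · 2‖f - g‖₂` (`V = Σ_{i<j} v ≤ N²M`, `|f|² ≤ |g|² + |f-g|(|f|+|g|)`,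
  Cauchy–Schwarz);
* `energy_dilate_le` (anchor `stub_hardWallLimit_shrink`) — hence
  `energy v Φ_s ≤ s⁻² energy v Φ + N²M · 2‖Φ_s - Φ‖₂`.

For potentials unbounded at `r → 0` the interaction step needs a pair-collision cutoff first
(stmt-9072's `stub_pairCutoff`/`stub_truncHigh`); for hard cores the dilation is not available at
all. All `[folklore]`.
-/

noncomputable section

namespace Summit.AtomisticToContinuum.BoseEinsteinCondensation.RimSqueeze

open Literature.MathematicalPhysics.QuantumManyBody.BoseGas
open MeasureTheory Filter Set
open scoped ENNReal NNReal ComplexConjugate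

variable {N : ℕ}

/-! ### Kinetic energy and `L²` defect of the dilated state -/

/-- The energy splits into kinetic and potential parts. [folklore] -/
theorem energy_eq_kinetic_add {ℓ : ℝ} (v : ℝ → ℝ≥0∞) (Θ : TrialState N ℓ) :
    energy v Θ = (∫⁻ X, kineticDensity Θ.ψ X) + ∫⁻ X, interaction v X * (‖Θ.ψ X‖₊ : ℝ≥0∞) ^ 2 := by
  unfold energy
  rw [lintegral_add_left (measurable_kineticDensity Θ.contDiff)]

/-- The free energy is the kinetic energy. [folklore] -/
theorem energy_zero_eq {ℓ : ℝ} (Θ : TrialState N ℓ) :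
    energy (fun _ => (0 : ℝ≥0∞)) Θ = ∫⁻ X, kineticDensity Θ.ψ X := by
  unfold energy interaction
  simp

/-- **Kinetic energy of the dilated state**: `∫|∇Φ_s|² = s⁻² ∫|∇Φ|²`. [folklore] -/
theorem lintegral_kineticDensity_dilate {ℓ : ℝ} (Φ : TrialState N ℓ) {s : ℝ} (hs : 0 < s) :
    ∫⁻ Y, kineticDensity (Φ.dilate hs).ψ Y =
      ENNReal.ofReal (s ^ 2)⁻¹ * ∫⁻ X, kineticDensity Φ.ψ X := by
  have h := TrialState.energy_dilate (fun _ => (0 : ℝ≥0∞)) Φ hs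
  have h0 : scalePotential s (fun _ => (0 : ℝ≥0∞)) = fun _ => 0 := by
    funext r
    rw [scalePotential_apply, mul_zero]
  rwa [h0, energy_zero_eq, energy_zero_eq] at h

/-- The normalisation defect of the dilation: `(c - 1)² s^d ≤ d (1 - s)` for `c = (s^d)^{-1/2}`,
`0 < s ≤ 1`. [folklore] -/
theorem dilate_norm_defect_le (d : ℕ) {s : ℝ} (hs : 0 < s) (hs1 : s ≤ 1) :
    (Real.sqrt ((s ^ d)⁻¹) - 1) ^ 2 * s ^ d ≤ d * (1 - s) := by
  set x : ℝ := s ^ d with hx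
  have hx0 : 0 < x := pow_pos hs d
  have hx1 : x ≤ 1 := pow_le_one₀ hs.le hs1
  set r : ℝ := Real.sqrt x with hr
  have hr0 : 0 < r := Real.sqrt_pos.2 hx0
  have hr2 : r ^ 2 = x := Real.sq_sqrt hx0.le
  have hr1 : r ≤ 1 := by nlinarith
  have hc : Real.sqrt (x⁻¹) = r⁻¹ := by rw [Real.sqrt_inv]
  have hid : (Real.sqrt (x⁻¹) - 1) ^ 2 * x = (1 - r) ^ 2 := by
    rw [hc, ← hr2]
    field_simp
  rw [hid]
  -- `(1 - r)² ≤ 1 - x ≤ d (1 - s)` (Bernoulli)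
  have hB : 1 + (d : ℝ) * (s - 1) ≤ s ^ d := by
    have := one_add_mul_le_pow (show (-2 : ℝ) ≤ s - 1 by linarith) d
    rwa [add_sub_cancel] at this
  nlinarith [mul_le_mul_of_nonneg_left hr1 hr0.le]

/-- **`L²` defect of the dilation** (`0 < s ≤ 1`):
`∫|Φ_s - Φ|² ≤ 2·3N(1 - s) + 2·3N·3(s⁻¹ - 1)²ℓ² ∫|∇Φ|²`. [folklore] -/
theorem lintegral_dilate_sub_sq_le {ℓ : ℝ} (Φ : TrialState N ℓ) {s : ℝ} (hs : 0 < s) (hs1 : s ≤ 1) :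
    ∫⁻ Y, (‖(Φ.dilate hs).ψ Y - Φ.ψ Y‖₊ : ℝ≥0∞) ^ 2 ≤
      2 * ENNReal.ofReal (3 * N * (1 - s)) +
        2 * ((3 * N : ℝ≥0∞) * ENNReal.ofReal (3 * (s⁻¹ - 1) ^ 2 * ℓ ^ 2) *
          ∫⁻ Y, kineticDensity Φ.ψ Y) := by
  set d : ℕ := Module.finrank ℝ (Config N) with hd
  have hdN : (d : ℝ) = 3 * N := by
    rw [hd]
    simp [Module.finrank_pi_fintype, mul_comm]
  set c : ℝ := Real.sqrt ((s ^ d)⁻¹) with hc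
  have hc1 : 1 ≤ c := by
    rw [hc, Real.le_sqrt' one_pos, one_pow]
    exact one_le_inv_iff₀.2 ⟨pow_pos hs d, pow_le_one₀ hs.le hs1⟩
  have hκ : 0 ≤ s⁻¹ - 1 := sub_nonneg.2 (one_le_inv_iff₀.2 ⟨hs, hs1⟩)
  have hΦm : Measurable Φ.ψ := Φ.contDiff.continuous.measurable
  -- the two pieces
  have hpt : ∀ Y, (‖(Φ.dilate hs).ψ Y - Φ.ψ Y‖₊ : ℝ≥0∞) ^ 2 ≤
      2 * (‖((c - 1 : ℝ) : ℂ) * Φ.ψ (s⁻¹ • Y)‖₊ : ℝ≥0∞) ^ 2 +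
        2 * (‖Φ.ψ ((1 + (s⁻¹ - 1)) • Y) - Φ.ψ Y‖₊ : ℝ≥0∞) ^ 2 := by
    intro Y
    have e : (Φ.dilate hs).ψ Y - Φ.ψ Y =
        ((c - 1 : ℝ) : ℂ) * Φ.ψ (s⁻¹ • Y) + (Φ.ψ ((1 + (s⁻¹ - 1)) • Y) - Φ.ψ Y) := by
      rw [TrialState.dilate_ψ, add_sub_cancel, ← hd, ← hc]
      push_cast
      ring
    rw [e]
    have := ennnorm_sq_le_two_mul (((c - 1 : ℝ) : ℂ) * Φ.ψ (s⁻¹ • Y) +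
      (Φ.ψ ((1 + (s⁻¹ - 1)) • Y) - Φ.ψ Y)) (Φ.ψ ((1 + (s⁻¹ - 1)) • Y) - Φ.ψ Y)
    rwa [add_sub_cancel_right] at this
  have hmeas : Measurable fun Y => 2 * (‖((c - 1 : ℝ) : ℂ) * Φ.ψ (s⁻¹ • Y)‖₊ : ℝ≥0∞) ^ 2 :=
    ((measurable_const.mul (hΦm.comp (measurable_const_smul s⁻¹))).nnnorm.coe_nnreal_ennreal.pow_const
      2).const_mul 2
  have h1 : ∫⁻ Y, (‖((c - 1 : ℝ) : ℂ) * Φ.ψ (s⁻¹ • Y)‖₊ : ℝ≥0∞) ^ 2 ≤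
      ENNReal.ofReal (3 * N * (1 - s)) := by
    simp only [ennorm_real_mul_sq (c - 1) (by linarith)]
    rw [lintegral_const_mul' _ _ ENNReal.ofReal_ne_top,
      lintegral_comp_smul_addHaar volume (fun X => (‖Φ.ψ X‖₊ : ℝ≥0∞) ^ 2) (inv_ne_zero hs.ne'),
      Φ.norm_eq, mul_one, ← hd, inv_pow, inv_inv, abs_of_nonneg (pow_nonneg hs.le d),
      ← ENNReal.ofReal_mul (sq_nonneg _), ← hdN]
    exact ENNReal.ofReal_le_ofReal (dilate_norm_defect_le d hs hs1)
  have h2 := lintegral_sub_dilate_sq_le Φ hκ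
  calc ∫⁻ Y, (‖(Φ.dilate hs).ψ Y - Φ.ψ Y‖₊ : ℝ≥0∞) ^ 2
      ≤ ∫⁻ Y, 2 * (‖((c - 1 : ℝ) : ℂ) * Φ.ψ (s⁻¹ • Y)‖₊ : ℝ≥0∞) ^ 2 +
          2 * (‖Φ.ψ ((1 + (s⁻¹ - 1)) • Y) - Φ.ψ Y‖₊ : ℝ≥0∞) ^ 2 := lintegral_mono hpt
    _ = 2 * (∫⁻ Y, (‖((c - 1 : ℝ) : ℂ) * Φ.ψ (s⁻¹ • Y)‖₊ : ℝ≥0∞) ^ 2) +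
          2 * ∫⁻ Y, (‖Φ.ψ ((1 + (s⁻¹ - 1)) • Y) - Φ.ψ Y‖₊ : ℝ≥0∞) ^ 2 := by
        rw [lintegral_add_left hmeas, lintegral_const_mul' _ _ (by norm_num),
          lintegral_const_mul' _ _ (by norm_num)]
    _ ≤ _ := add_le_add (mul_le_mul_right h1 2) (mul_le_mul_right h2 2)

/-! ### The potential energy is `L²`-Lipschitz for bounded pair potentials -/

/-- The interaction of a potential bounded by `M` is bounded by `N² M`. [folklore] -/
theorem interaction_le_of_le {v : ℝ → ℝ≥0∞} {M : ℝ≥0∞} (hv : ∀ r, v r ≤ M) (X : Config N) :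
    interaction v X ≤ (N * N : ℝ≥0∞) * M := by
  unfold interaction
  calc ∑ i : Fin N, ∑ j ∈ Finset.univ.filter (fun j => i < j), v (dist (X i) (X j))
      ≤ ∑ _i : Fin N, ∑ _j : Fin N, M := by
        refine Finset.sum_le_sum fun i _ => ?_
        exact (Finset.sum_le_sum_of_subset_of_nonneg (Finset.filter_subset _ _)
          (fun j _ _ => zero_le)).trans (Finset.sum_le_sum fun j _ => hv _)
    _ = (N * N : ℝ≥0∞) * M := by
        simp only [Finset.sum_const, Finset.card_univ, Fintype.card_fin, nsmul_eq_mul]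
        ring

/-- **The potential energy is `L²`-Lipschitz on the unit ball for bounded pair potentials**:
`∫ V|f|² ≤ ∫ V|g|² + N²M · 2 (∫|f - g|²)^{1/2}` for measurable `f, g` of `L²`-norm `≤ 1` and
`v ≤ M` (`|f|² ≤ |g|² + |f - g|(|f| + |g|)`, `V ≤ N²M`, Cauchy–Schwarz and `‖|f| + |g|‖₂ ≤ 2`).
[folklore] -/
theorem lintegral_interaction_sq_le_add {v : ℝ → ℝ≥0∞} (hvm : Measurable v) {M : ℝ≥0∞}
    (hM : M ≠ ⊤) (hv : ∀ r, v r ≤ M) {f g : Config N → ℂ} (hf : Measurable f) (hg : Measurable g)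
    (hf1 : ∫⁻ X, (‖f X‖₊ : ℝ≥0∞) ^ 2 ≤ 1) (hg1 : ∫⁻ X, (‖g X‖₊ : ℝ≥0∞) ^ 2 ≤ 1) :
    ∫⁻ X, interaction v X * (‖f X‖₊ : ℝ≥0∞) ^ 2 ≤
      (∫⁻ X, interaction v X * (‖g X‖₊ : ℝ≥0∞) ^ 2) +
        (N * N : ℝ≥0∞) * M * (2 * (∫⁻ X, (‖f X - g X‖₊ : ℝ≥0∞) ^ 2) ^ (1 / 2 : ℝ)) := by
  set a : Config N → ℝ≥0∞ := fun X => (‖f X‖₊ : ℝ≥0∞) with ha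
  set b : Config N → ℝ≥0∞ := fun X => (‖g X‖₊ : ℝ≥0∞) with hb
  set dd : Config N → ℝ≥0∞ := fun X => (‖f X - g X‖₊ : ℝ≥0∞) with hdd
  have ham : Measurable a := hf.nnnorm.coe_nnreal_ennreal
  have hbm : Measurable b := hg.nnnorm.coe_nnreal_ennreal
  have hdm : Measurable dd := (hf.sub hg).nnnorm.coe_nnreal_ennreal
  have hVm : Measurable (interaction (N := N) v) := measurable_interaction hvm
  -- pointwise
  have hpt : ∀ X, interaction v X * a X ^ 2 ≤
      interaction v X * b X ^ 2 + (N * N : ℝ≥0∞) * M * (dd X * (a X + b X)) := by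
    intro X
    have htri : a X ≤ b X + dd X := by
      have := norm_le_insert' (f X) (g X)
      simp only [ha, hb, hdd]
      exact_mod_cast this
    calc interaction v X * a X ^ 2 ≤ interaction v X * (b X ^ 2 + dd X * (a X + b X)) := by
          gcongr
          exact sq_le_sq_add_mul_add htri
      _ = interaction v X * b X ^ 2 + interaction v X * (dd X * (a X + b X)) := mul_add _ _ _
      _ ≤ _ := by
          gcongr
          exact interaction_le_of_le hv X
  -- Cauchy–Schwarz
  have hcs : ∫⁻ X, dd X * (a X + b X) ≤
      (∫⁻ X, dd X ^ 2) ^ (1 / 2 : ℝ) * (∫⁻ X, (a X + b X) ^ 2) ^ (1 / 2 : ℝ) := by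
    have h := ENNReal.lintegral_mul_le_Lp_mul_Lq volume Real.HolderConjugate.two_two
      hdm.aemeasurable (ham.add hbm).aemeasurable
    simpa only [Pi.mul_apply, Pi.add_apply, ENNReal.rpow_two, one_div] using h
  have hsq2 : ∀ x y : ℝ≥0∞, (x + y) ^ 2 ≤ 2 * x ^ 2 + 2 * y ^ 2 := by
    intro x y
    rcases eq_or_ne x ⊤ with rfl | hx
    · simp
    rcases eq_or_ne y ⊤ with rfl | hy
    · simp
    lift x to ℝ≥0 using hx
    lift y to ℝ≥0 using hy
    have h : ((x + y) ^ 2 : ℝ≥0) ≤ 2 * x ^ 2 + 2 * y ^ 2 := by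
      rw [← NNReal.coe_le_coe]
      push_cast
      nlinarith [sq_nonneg ((x : ℝ) - y)]
    exact_mod_cast h
  have hab2 : (∫⁻ X, (a X + b X) ^ 2) ^ (1 / 2 : ℝ) ≤ 2 := by
    have h4 : ∫⁻ X, (a X + b X) ^ 2 ≤ 2 ^ 2 := by
      calc ∫⁻ X, (a X + b X) ^ 2 ≤ ∫⁻ X, 2 * a X ^ 2 + 2 * b X ^ 2 :=
            lintegral_mono fun X => hsq2 (a X) (b X)
        _ = 2 * (∫⁻ X, a X ^ 2) + 2 * ∫⁻ X, b X ^ 2 := by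
            rw [lintegral_add_left ((ham.pow_const 2).const_mul 2), lintegral_const_mul' _ _ (by norm_num),
              lintegral_const_mul' _ _ (by norm_num)]
        _ ≤ 2 * 1 + 2 * 1 := add_le_add (mul_le_mul_right hf1 2) (mul_le_mul_right hg1 2)
        _ = 2 ^ 2 := by norm_num
    calc (∫⁻ X, (a X + b X) ^ 2) ^ (1 / 2 : ℝ) ≤ ((2 : ℝ≥0∞) ^ 2) ^ (1 / 2 : ℝ) := by gcongr
      _ = 2 := by rw [← ENNReal.rpow_natCast, ← ENNReal.rpow_mul]; norm_num
  calc ∫⁻ X, interaction v X * a X ^ 2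
      ≤ ∫⁻ X, interaction v X * b X ^ 2 + (N * N : ℝ≥0∞) * M * (dd X * (a X + b X)) :=
        lintegral_mono hpt
    _ = (∫⁻ X, interaction v X * b X ^ 2) + (N * N : ℝ≥0∞) * M * ∫⁻ X, dd X * (a X + b X) := by
        rw [lintegral_add_left (show Measurable (fun X => interaction v X * b X ^ 2) from
          hVm.mul (hbm.pow_const 2)), lintegral_const_mul' _ _ (ENNReal.mul_ne_top
            (ENNReal.mul_ne_top (ENNReal.natCast_ne_top N) (ENNReal.natCast_ne_top N)) hM)]
    _ ≤ _ := by
        gcongr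
        calc ∫⁻ X, dd X * (a X + b X) ≤ _ := hcs
          _ ≤ (∫⁻ X, dd X ^ 2) ^ (1 / 2 : ℝ) * 2 := mul_le_mul_right hab2 _
          _ = _ := mul_comm _ _

/-! ### The energy of the dilated state -/

/-- **Energy of the shrunk state for a bounded pair potential** (`0 < s ≤ 1`, `v ≤ M < ⊤`):
`energy v Φ_s ≤ s⁻² energy v Φ + N²M · 2‖Φ_s - Φ‖₂`. [folklore] -/
theorem energy_dilate_le {ℓ : ℝ} {v : ℝ → ℝ≥0∞} (hvm : Measurable v) {M : ℝ≥0∞} (hM : M ≠ ⊤)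
    (hv : ∀ r, v r ≤ M) (Φ : TrialState N ℓ) {s : ℝ} (hs : 0 < s) (hs1 : s ≤ 1) :
    energy v (Φ.dilate hs) ≤ ENNReal.ofReal (s ^ 2)⁻¹ * energy v Φ +
      (N * N : ℝ≥0∞) * M *
        (2 * (∫⁻ Y, (‖(Φ.dilate hs).ψ Y - Φ.ψ Y‖₊ : ℝ≥0∞) ^ 2) ^ (1 / 2 : ℝ)) := by
  rw [energy_eq_kinetic_add, energy_eq_kinetic_add v Φ, lintegral_kineticDensity_dilate Φ hs]
  have hPE := lintegral_interaction_sq_le_add hvm hM hv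
    (Φ.dilate hs).contDiff.continuous.measurable Φ.contDiff.continuous.measurable
    (Φ.dilate hs).norm_eq.le Φ.norm_eq.le
  have hs2 : 1 ≤ ENNReal.ofReal (s ^ 2)⁻¹ := by
    rw [← ENNReal.ofReal_one]
    exact ENNReal.ofReal_le_ofReal (one_le_inv_iff₀.2 ⟨by positivity, pow_le_one₀ hs.le hs1⟩)
  calc ENNReal.ofReal (s ^ 2)⁻¹ * (∫⁻ X, kineticDensity Φ.ψ X) +
        ∫⁻ X, interaction v X * (‖(Φ.dilate hs).ψ X‖₊ : ℝ≥0∞) ^ 2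
      ≤ ENNReal.ofReal (s ^ 2)⁻¹ * (∫⁻ X, kineticDensity Φ.ψ X) +
        ((∫⁻ X, interaction v X * (‖Φ.ψ X‖₊ : ℝ≥0∞) ^ 2) + (N * N : ℝ≥0∞) * M *
          (2 * (∫⁻ Y, (‖(Φ.dilate hs).ψ Y - Φ.ψ Y‖₊ : ℝ≥0∞) ^ 2) ^ (1 / 2 : ℝ))) :=
        add_le_add le_rfl hPE
    _ ≤ ENNReal.ofReal (s ^ 2)⁻¹ * (∫⁻ X, kineticDensity Φ.ψ X) +
        (ENNReal.ofReal (s ^ 2)⁻¹ * (∫⁻ X, interaction v X * (‖Φ.ψ X‖₊ : ℝ≥0∞) ^ 2) +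
          (N * N : ℝ≥0∞) * M *
            (2 * (∫⁻ Y, (‖(Φ.dilate hs).ψ Y - Φ.ψ Y‖₊ : ℝ≥0∞) ^ 2) ^ (1 / 2 : ℝ))) := by
        gcongr
        exact le_mul_of_one_le_left zero_le hs2
    _ = _ := by ring

/-- Transport of a trial state along an equality of sides keeps the wave function. [folklore] -/
theorem eqRec_trialState_ψ {a b : ℝ} (h : a = b) (Θ : TrialState N a) : (h ▸ Θ).ψ = Θ.ψ := by
  subst h
  rfl

/-- Transport of a trial state along an equality of sides keeps the energy. [folklore] -/
theorem energy_eqRec_trialState {a b : ℝ} (h : a = b) (v : ℝ → ℝ≥0∞) (Θ : TrialState N a) :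
    energy v (h ▸ Θ) = energy v Θ := by
  subst h
  rfl

/-- **Anchor of this block** (quantified form of `energy_dilate_le`). [folklore] -/
theorem stub_hardWallLimit_shrink : ∀ {N : ℕ} {ℓ : ℝ} {v : ℝ → ℝ≥0∞}, Measurable v → ∀ {M : ℝ≥0∞}, M ≠ ⊤ → (∀ r, v r ≤ M) → ∀ (Φ : TrialState N ℓ) {s : ℝ} (hs : 0 < s), s ≤ 1 → energy v (Φ.dilate hs) ≤ ENNReal.ofReal (s ^ 2)⁻¹ * energy v Φ + (N * N : ℝ≥0∞) * M * (2 * (∫⁻ Y : Config N, (‖(Φ.dilate hs).ψ Y - Φ.ψ Y‖₊ : ℝ≥0∞) ^ 2) ^ (1 / 2 : ℝ)) :=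
  fun hvm _ hM hv Φ _ hs hs1 => energy_dilate_le hvm hM hv Φ hs hs1

end Summit.AtomisticToContinuum.BoseEinsteinCondensation.RimSqueeze

end
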